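import Literature.AlgebraicGeometry.Hu2025.Proofs.S03Pluecker.Prop36Minors
import HarnessLib

/-!
# Hu 2025 §3.2 — DISCHARGE of `C17L64` («one calculates and finds |𝕀^lt_{3,n}| = Υ = C(n,3) − 1 − 3(n−3)», chunk p0017 l.64–68): `C17L64_holds`
# (row 101b, typer res-type-009)

**HONEST FRAMING (D-0012/D-0089).** A theorem about OUR typed transcription (`plIndexSet`, `IsLt`, `Upsilon`); the preprint [Hu2025] stays «under
review». Proof: `|𝕀_{3,n}| = C(n,3)` (increasing triples ↔ 3-subsets of `[n]`), and the non-leading indices are `(123)` and `(12a), (13a), (23a)`,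
`4 ≤ a ≤ n` (chunk p0017 l.61–62), `3(n−3) + 1` of them. AI proof, weaker than expert review; nothing here is progress on resolution of singularities.
-/

noncomputable section

namespace Literature.AlgebraicGeometry.Hu2025.Statements.S03Pluecker

open MvPolynomial

universe u

variable {n : ℕ}

/-! ## §1 `|𝕀_{3,n}| = C(n,3)` -/

/-- The index set of an increasing triple in `[n]` is a 3-subset of `[n]`.
[cite: Hu2025, «|𝕀^lt_{3,n}| = Υ» (C17L64), p.35 l.37–46 (unrefereed preprint arXiv:2507.21400v1 under adjudication, D-0012/D-0089
— kernel support on OUR typed carriers of row 101; nothing of the source asserted)] -/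
theorem triSet_mem_powersetCard {t : ℕ × ℕ × ℕ} (ht : t ∈ plIndexSet n) : triSet t ∈ (Finset.Icc 1 n).powersetCard 3 := by
  obtain ⟨a, b, c⟩ := t
  rw [mem_plIndexSet_iff] at ht
  simp only at ht
  rw [Finset.mem_powersetCard]
  unfold triSet
  simp only
  constructor
  · intro x hx
    simp only [Finset.mem_insert, Finset.mem_singleton] at hx
    rw [Finset.mem_Icc]
    omega
  · rw [Finset.card_insert_of_notMem (by simp; omega), Finset.card_insert_of_notMem (by simp; omega), Finset.card_singleton]

/-- An increasing triple is determined by its index set.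
[cite: Hu2025, «|𝕀^lt_{3,n}| = Υ» (C17L64), p.35 l.37–46 (unrefereed preprint arXiv:2507.21400v1 under adjudication, D-0012/D-0089
— kernel support on OUR typed carriers of row 101; nothing of the source asserted)] -/
theorem triSet_injOn {t t' : ℕ × ℕ × ℕ} (ht : t ∈ plIndexSet n) (ht' : t' ∈ plIndexSet n) (h : triSet t = triSet t') : t = t' := by
  obtain ⟨a, b, c⟩ := t
  obtain ⟨a', b', c'⟩ := t'
  rw [mem_plIndexSet_iff] at ht ht'
  simp only at ht ht'
  unfold triSet at h
  simp only at h
  have m1 : a ∈ ({a', b', c'} : Finset ℕ) := by rw [← h]; simp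
  have m2 : b ∈ ({a', b', c'} : Finset ℕ) := by rw [← h]; simp
  have m3 : c ∈ ({a', b', c'} : Finset ℕ) := by rw [← h]; simp
  have m4 : a' ∈ ({a, b, c} : Finset ℕ) := by rw [h]; simp
  have m5 : b' ∈ ({a, b, c} : Finset ℕ) := by rw [h]; simp
  have m6 : c' ∈ ({a, b, c} : Finset ℕ) := by rw [h]; simp
  simp only [Finset.mem_insert, Finset.mem_singleton] at m1 m2 m3 m4 m5 m6
  simp only [Prod.mk.injEq]
  omega

/-- Every 3-subset of `[n]` is the index set of an increasing triple.
[cite: Hu2025, «|𝕀^lt_{3,n}| = Υ» (C17L64), p.35 l.37–46 (unrefereed preprint arXiv:2507.21400v1 under adjudication, D-0012/D-0089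
— kernel support on OUR typed carriers of row 101; nothing of the source asserted)] -/
theorem exists_triSet_eq {s : Finset ℕ} (hs : s ∈ (Finset.Icc 1 n).powersetCard 3) : ∃ t ∈ plIndexSet n, triSet t = s := by
  rw [Finset.mem_powersetCard] at hs
  obtain ⟨hsub, hcard⟩ := hs
  obtain ⟨x, y, z, hxy, hxz, hyz, rfl⟩ := Finset.card_eq_three.mp hcard
  have hx := Finset.mem_Icc.mp (hsub (by simp : x ∈ ({x, y, z} : Finset ℕ)))
  have hy := Finset.mem_Icc.mp (hsub (by simp : y ∈ ({x, y, z} : Finset ℕ)))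
  have hz := Finset.mem_Icc.mp (hsub (by simp : z ∈ ({x, y, z} : Finset ℕ)))
  refine ⟨sort3 x y z, ?_, ?_⟩
  · rw [mem_plIndexSet_iff]
    unfold sort3
    simp only
    omega
  · unfold triSet sort3
    ext w
    simp only [Finset.mem_insert, Finset.mem_singleton]
    omega

/-- **`|𝕀_{3,n}| = C(n,3)`.**
[cite: Hu2025, «|𝕀^lt_{3,n}| = Υ» (C17L64), p.35 l.37–46 (unrefereed preprint arXiv:2507.21400v1 under adjudication, D-0012/D-0089
— kernel support on OUR typed carriers of row 101; nothing of the source asserted)] -/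
theorem card_plIndexSet : (plIndexSet n).card = n.choose 3 := by
  have h : ((Finset.Icc 1 n).powersetCard 3).card = n.choose 3 := by
    rw [Finset.card_powersetCard, Nat.card_Icc, Nat.add_sub_cancel]
  rw [← h]
  exact Finset.card_bij (fun t _ => triSet t) (fun t ht => triSet_mem_powersetCard ht)
    (fun t ht t' ht' h => triSet_injOn ht ht' h) (fun s hs => by
      obtain ⟨t, ht, h⟩ := exists_triSet_eq hs
      exact ⟨t, ht, h⟩)

/-! ## §2 The non-leading indices `(123), (12a), (13a), (23a)` and the count of `𝕀^lt_{3,n}` -/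

/-- The non-leading indices, explicitly.
[cite: Hu2025, «|𝕀^lt_{3,n}| = Υ» (C17L64), p.35 l.37–46 (unrefereed preprint arXiv:2507.21400v1 under adjudication, D-0012/D-0089
— kernel support on OUR typed carriers of row 101; nothing of the source asserted)] -/
theorem filter_not_isLt_eq (hn : 3 ≤ n) :
    (plIndexSet n).filter (fun t => ¬ IsLt t) =
      insert mTri (((Finset.Icc 4 n).image fun a => ((1 : ℕ), (2 : ℕ), a)) ∪ ((Finset.Icc 4 n).image fun a => ((1 : ℕ), (3 : ℕ), a)) ∪
        ((Finset.Icc 4 n).image fun a => ((2 : ℕ), (3 : ℕ), a))) := by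
  ext ⟨a, b, c⟩
  simp only [Finset.mem_filter, Finset.mem_insert, Finset.mem_union, Finset.mem_image, Finset.mem_Icc, mTri, Prod.mk.injEq]
  rw [mem_plIndexSet_iff]
  simp only
  constructor
  · rintro ⟨hmem, hnlt⟩
    have hb : b ≤ 3 := by
      by_contra hb
      exact hnlt (isLt_of_lt (a := a) (by omega) hmem.2.2.2)
    by_cases hc : c ≤ 3
    · left; omega
    · right
      rcases (show (a = 1 ∧ b = 2) ∨ (a = 1 ∧ b = 3) ∨ (a = 2 ∧ b = 3) by omega) with ⟨rfl, rfl⟩ | ⟨rfl, rfl⟩ | ⟨rfl, rfl⟩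
      · exact Or.inl (Or.inl ⟨c, by omega, rfl, rfl, rfl⟩)
      · exact Or.inl (Or.inr ⟨c, by omega, rfl, rfl, rfl⟩)
      · exact Or.inr ⟨c, by omega, rfl, rfl, rfl⟩
  · rintro (⟨rfl, rfl, rfl⟩ | ((⟨x, hx, rfl, rfl, rfl⟩ | ⟨x, hx, rfl, rfl, rfl⟩) | ⟨x, hx, rfl, rfl, rfl⟩))
    · exact ⟨by omega, not_isLt_of_le (a := 1) (b := 2) (c := 3) (by norm_num) (by norm_num) (by norm_num)⟩
    · exact ⟨by omega, not_isLt_of_le (a := 1) (b := 2) (c := x) (by norm_num) (by norm_num) (by norm_num)⟩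
    · exact ⟨by omega, not_isLt_of_le (a := 1) (b := 3) (c := x) (by norm_num) (by norm_num) (by norm_num)⟩
    · exact ⟨by omega, not_isLt_of_le (a := 2) (b := 3) (c := x) (by norm_num) (by norm_num) (by norm_num)⟩

/-- There are `3(n−3) + 1` non-leading indices (`n ≥ 3`).
[cite: Hu2025, «|𝕀^lt_{3,n}| = Υ» (C17L64), p.35 l.37–46 (unrefereed preprint arXiv:2507.21400v1 under adjudication, D-0012/D-0089
— kernel support on OUR typed carriers of row 101; nothing of the source asserted)] -/
theorem card_filter_not_isLt (hn : 3 ≤ n) : ((plIndexSet n).filter (fun t => ¬ IsLt t)).card = 3 * (n - 3) + 1 := by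
  rw [filter_not_isLt_eq hn, Finset.card_insert_of_notMem]
  · have hi1 : Function.Injective fun a : ℕ => ((1 : ℕ), (2 : ℕ), a) := fun a b h => by simpa using h
    have hi2 : Function.Injective fun a : ℕ => ((1 : ℕ), (3 : ℕ), a) := fun a b h => by simpa using h
    have hi3 : Function.Injective fun a : ℕ => ((2 : ℕ), (3 : ℕ), a) := fun a b h => by simpa using h
    rw [Finset.card_union_of_disjoint, Finset.card_union_of_disjoint, Finset.card_image_of_injective _ hi1,
      Finset.card_image_of_injective _ hi2, Finset.card_image_of_injective _ hi3, Nat.card_Icc]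
    · omega
    · rw [Finset.disjoint_left]
      rintro ⟨a, b, c⟩ h1 h2
      simp only [Finset.mem_image, Prod.mk.injEq] at h1 h2
      omega
    · rw [Finset.disjoint_left]
      rintro ⟨a, b, c⟩ h1 h2
      simp only [Finset.mem_union, Finset.mem_image, Prod.mk.injEq] at h1 h2
      omega
  · unfold mTri
    simp only [Finset.mem_union, Finset.mem_image, Finset.mem_Icc, Prod.mk.injEq, not_or, not_exists, not_and]
    refine ⟨⟨?_, ?_⟩, ?_⟩ <;> intro x hx <;> omega

/-- **`|𝕀^lt_{3,n}| = Υ`** as a `Finset` count (`n ≥ 3`).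
[cite: Hu2025, «|𝕀^lt_{3,n}| = Υ» (C17L64), p.35 l.37–46 (unrefereed preprint arXiv:2507.21400v1 under adjudication, D-0012/D-0089
— kernel support on OUR typed carriers of row 101; nothing of the source asserted)] -/
theorem card_filter_isLt (hn : 3 ≤ n) : ((plIndexSet n).filter fun t => IsLt t).card = Upsilon n := by
  have h := Finset.card_filter_add_card_filter_not (s := plIndexSet n) (fun t => IsLt t)
  rw [card_filter_not_isLt hn, card_plIndexSet] at h
  unfold Upsilon
  omega

/-- **`C17L64` HOLDS** as typed: `|𝕀^lt_{3,n}| = Υ = C(n,3) − 1 − 3(n−3)` for `n > 3`.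
[cite: Hu2025, «|𝕀^lt_{3,n}| = Υ» (C17L64), p.35 l.37–46 (unrefereed preprint arXiv:2507.21400v1 under adjudication, D-0012/D-0089
— kernel support on OUR typed carriers of row 101; nothing of the source asserted)] -/
theorem C17L64_holds : C17L64 n := by
  intro hP
  have hn : 3 ≤ n := le_of_lt hP.three_lt
  let e : {u : plIndex n // IsLt u.1} ≃ ↥((plIndexSet n).filter fun t => IsLt t) :=
    { toFun := fun u => ⟨u.1.1, Finset.mem_filter.mpr ⟨u.1.2, u.2⟩⟩
      invFun := fun t => ⟨⟨t.1, (Finset.mem_filter.mp t.2).1⟩, (Finset.mem_filter.mp t.2).2⟩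
      left_inv := fun u => rfl
      right_inv := fun t => rfl }
  rw [Nat.card_congr e, Nat.card_eq_fintype_card, Fintype.card_coe, card_filter_isLt hn]

end Literature.AlgebraicGeometry.Hu2025.Statements.S03Pluecker

end
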